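import Literature.Algebra.EuclideanLattices.ARVerifierCompleteness
import Literature.Algebra.EuclideanLattices.GapCVPPrime
import HarnessLib

/-!
# The integer Aharonov–Regev verifier accepts random dual samples with probability `≥ 0.829` at gap `100√n` (Regev 2009, Lemma 3.20, NO case)

Topic `Algebra/EuclideanLattices` (family `pqc`). Sequel of `ARVerifierCompleteness.lean` (the
integer-arithmetic Aharonov–Regev verifier `ARVerifier.Accepts` of `ARVerifier.lean`: soundness
`not_accepts_of_infDist_le`, completeness in EXISTENCE form `exists_accepts_of_far` at gap `200√n`),
written for the decomposition of the named fact
`Literature.Computability.Cryptography.regev_lwe_to_gapSVP_quantum` (pqc.S19, GapSVP form; Regev,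
J. ACM 56 (2009), Thm 1.1 via Thm 3.1 + §3.3), hypothesis `hL` = **Lemma 3.20** of the landed
assembly `regev_lwe_to_gapSVP_quantum_of_dgs` (`Cryptography/RegevReduction.lean`).

Regev's Lemma 3.20 ("for any `γ(n) ≥ 1` there is a polynomial time reduction from
`GapCVP'_{100√n·γ(n)}` to `DGS_{√n γ(n)/λ₁(L*)}`") calls the `DGS` oracle `N = poly(n)` times on
`(L*, 1/(100d))`, runs "the NP verifier for coGapCVP shown in [AharonovR04] … an efficient algorithm,
call it `𝒱`", and accepts iff `𝒱` rejects; its correctness is (p. 22 of arXiv:2401.03703):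
(YES) "`dist(t, L) ≤ d`, and hence `𝒱` must reject (irrespective of the `w`'s)" — in the tree:
`ARVerifier.not_accepts_of_infDist_le`; (NO) "`1/(100d) > √n γ(n)/λ₁(L)`, and hence `w₁, …, w_N`
are guaranteed to be valid samples from `D_{L*,1/(100d)}`. Moreover, `dist(t, L) > 100√n γ(n) d ≥
100√n d`, and hence `𝒱` accepts with probability exponentially close to `1`."

This file PROVES the NO half for the tree's integer variant of `𝒱`, in PROBABILITY form and at
Regev's gap `100√n` (the tree's second-moment analysis gives the constant `0.829` in place of
"exponentially close to `1`", which is all a bounded-error decider needs):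

* `measureReal_not_good_dualSamples_le` — the measure form of `exists_good_dualSamples`
  (`DualGaussianSampling.lean`): under `N` i.i.d. draws from `D_{L*,1/s}` the tuples violating one of
  the three sample properties (norm `< c√n/s`; distance-to-`ℤ` statistic; Frobenius deviation of
  the truncated moment matrix) have probability at most the same three-term budget
  `N (c√(2πe)e^{-πc²})ⁿ + N/(64a²) + N n² R⁴/θ` (union bound, Chebyshev, Markov — AR05 Claim 6.1,
  Lemmas 6.2–6.3 in second-moment form).
* `ARVerifier.fRatio_le_of_far_one` — AR Lemma 3.1 with tail constant `c = 1`: if every lattice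
  point is at distance `≥ s√n` from `t` then `f_s(t) ≤ √(2πe) e^{-π} ≤ 5/16` (`n ≥ 1`); this is
  what moves the gap from the `200√n` of `exists_accepts_of_far` (`c = 2`) to Regev's `100√n`, the
  check-3 margin `1/50 + 1/100 ≤ (1 − 5/16)/(2π²)` still holding (`const_ineq_one`).
* `ARVerifier.budget_le` — the budget of `nSamples n = 3000(n+1)⁴` samples is `≤ 171/1000`
  (the proof of `budget_lt_one`, kept quantitative).
* **`ARVerifier.le_measureReal_accepts_certOf`** — for `B` nonsingular, `d > 0` and
  `dist(t, L(B)) > 100√n · d`: with probability `≥ 829/1000` over `ω ∼ D_{L(B)*, 1/(100d)}^{⊗N}`,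
  `N = nSamples n`, the certificate `certOf I t ω` (`C = adj B`, `D = det B`, `aⱼ = B wⱼ`,
  `mⱼ = round ⟪t, wⱼ⟫`) is ACCEPTED; promise forms `…_of_gapCVP_no` (`GapCVP_{100√n}`) and
  `…_of_gapCVP'_no` (Regev's NO instances of `GapCVP′_{100√n·γ}`, `γ ≥ 1`, MR07 Def. 5.21 sets of
  `GapCVPPrime.lean`), and the existence corollary `exists_accepts_of_far_one` at gap `100√n`.

Everything here is PROVED; theorems only (no definition, no named fact). Not here: the machine form
of Lemma 3.20 (dual-basis computation `adj B`, `det B` in `FP`; the `N`-fold sampler product; the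
verifier machine with its trace test; the assembly through the classical wrap), for which this file
is the analytic input of the NO case.

## References

* O. Regev, *On lattices, learning with errors, random linear codes, and cryptography*, J. ACM 56
  (2009), art. 34 = arXiv:2401.03703, §3.3, Defs. 3.18–3.19, Lemma 3.20 and its proof (pp. 21–22)
  [Regev2009].
* D. Aharonov, O. Regev, *Lattice problems in NP ∩ coNP*, J. ACM 52 (2005) 749–765, §6.2
  (Claim 6.1, Lemmas 6.2, 6.3), Lemma 3.1 [AharonovRegev2005].
* D. Micciancio, O. Regev, *Worst-case to average-case reductions based on Gaussian measures*,
  SIAM J. Comput. 37 (2007), Def. 5.21 (`GapCVP′`) [MicciancioRegev2007].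
-/

noncomputable section

open Matrix Metric MeasureTheory Module Literature.NumberTheory.Sieve.Vinogradov
  Literature.Probability.Moments ProbabilityTheory
open scoped Real InnerProductSpace ENNReal

namespace Literature.Algebra.EuclideanLattices

/-! ### Bad sample tuples have small probability -/

section Sampling

variable {V : Type*} [NormedAddCommGroup V] [InnerProductSpace ℝ V] [FiniteDimensional ℝ V]
  [MeasurableSpace V] [BorelSpace V]

variable (L : Submodule ℤ V) [DiscreteTopology L] [IsZLattice ℝ L]

variable {ι : Type*} [Fintype ι]

/-- **Bad witness tuples are rare** (measure form of `exists_good_dualSamples`): under `N` independent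
draws from `D_{L*, 1/s}`, with `R = c√n/s`, `c ≥ 1/√(2π)`, `a > 0`, `θ > 0`, the tuples which FAIL one
of (i) all `‖wⱼ‖ < R`, (ii) `∑ⱼ ‖⟪x, wⱼ⟫‖²_{ℝ/ℤ} > N (1 − f_s(x))/(2π²) − a`, (iii) Frobenius deviation
`< θ` of the truncated empirical moment matrix, have probability at most
`N (c√(2πe)e^{-πc²})ⁿ + N/(64a²) + N n² R⁴/θ` (union bound; Banaszczyk tail, Chebyshev, Markov). In
print: Claim 6.1 and Lemmas 6.2–6.3 with Chernoff–Hoeffding and an `ε`-net, "with probability at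
least `3/4`" each. [cite: AharonovRegev2005, §6.2 (Claim 6.1, Lemmas 6.2–6.3, pp. 11–12) — variant] -/
theorem measureReal_not_good_dualSamples_le {s c a θ : ℝ} (hs : 0 < s) (hc : 1 / Real.sqrt (2 * π) ≤ c)
    (ha : 0 < a) (hθ : 0 < θ) (x : V) (b : OrthonormalBasis ι ℝ V) (N : ℕ) :
    (IID.draws (dualGaussian L s).toMeasure N).real
        {ω | ¬ ((∀ j, ‖(ω j : V)‖ < c * s⁻¹ * Real.sqrt (finrank ℝ V)) ∧
          (N * ((1 - (∑' y : L, gaussianFunction s ((y : V) - x)) / ∑' y : L, gaussianFunction s (y : V)) /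
              (2 * π ^ 2)) - a < ∑ j, distInt ⟪x, (ω j : V)⟫_ℝ ^ 2) ∧
          (∑ k : ι × ι, (∑ j, momentEntry b (c * s⁻¹ * Real.sqrt (finrank ℝ V)) k (ω j : V) -
              N * ∫ w, momentEntry b (c * s⁻¹ * Real.sqrt (finrank ℝ V)) k (w : V)
                ∂(dualGaussian L s).toMeasure) ^ 2 < θ))} ≤
      N * (c * Real.sqrt (2 * π * Real.exp 1) * Real.exp (-π * c ^ 2)) ^ finrank ℝ V +
        N * (1 / 4) ^ 2 / (4 * a ^ 2) +
        N * Fintype.card (ι × ι) * ((c * s⁻¹ * Real.sqrt (finrank ℝ V)) ^ 2) ^ 2 / θ := by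
  set R : ℝ := c * s⁻¹ * Real.sqrt (finrank ℝ V) with hR
  have hc0 : 0 < c := lt_of_lt_of_le (by positivity) hc
  have hR0 : 0 ≤ R := by rw [hR]; positivity
  set μ := (dualGaussian L s).toMeasure with hμ
  -- the three bad events
  set B1 : Set (Fin N → dualLattice L) := {ω | ∃ j, ω j ∈ {w : dualLattice L | R ≤ ‖(w : V)‖}} with hB1
  set m : ℝ := ∫ w, distInt ⟪x, (w : V)⟫_ℝ ^ 2 ∂μ with hm
  set B2 : Set (Fin N → dualLattice L) := {ω | ∑ j, distInt ⟪x, (ω j : V)⟫_ℝ ^ 2 ≤ N * m - a} with hB2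
  set B3 : Set (Fin N → dualLattice L) := {ω | θ ≤ ∑ k : ι × ι, (∑ j, momentEntry b R k (ω j : V) -
      N * ∫ w, momentEntry b R k (w : V) ∂μ) ^ 2} with hB3
  have h1 : (IID.draws μ N).real B1 ≤ N * (c * Real.sqrt (2 * π * Real.exp 1) * Real.exp (-π * c ^ 2)) ^ finrank ℝ V := by
    refine (IID.measureReal_exists_mem_le (μ := μ) (N := N) _).trans ?_
    exact mul_le_mul_of_nonneg_left (measureReal_dualGaussian_tail_le L hs hc) (Nat.cast_nonneg _)
  have h2 : (IID.draws μ N).real B2 ≤ N * (1 / 4) ^ 2 / (4 * a ^ 2) :=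
    IID.measureReal_sum_le_sub_le (μ := μ) (N := N) (g := fun w : dualLattice L ↦ distInt ⟪x, (w : V)⟫_ℝ ^ 2)
      (fun w ↦ sq_nonneg _) (fun w ↦ by
        have h := distInt_le_half ⟪x, (w : V)⟫_ℝ
        have h0 := distInt_nonneg ⟪x, (w : V)⟫_ℝ
        nlinarith) ha
  have h3 : (IID.draws μ N).real B3 ≤ N * Fintype.card (ι × ι) * (R ^ 2) ^ 2 / θ :=
    IID.measureReal_le_sum_sq_sub_le (μ := μ) (N := N) (h := fun k (w : dualLattice L) ↦ momentEntry b R k (w : V))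
      (fun k w ↦ abs_momentEntry_le b hR0 k _) hθ
  -- the mean of the distance-to-`ℤ` statistic
  have hmean := le_integral_dualGaussian_distInt_sq L hs x
  rw [← hμ, ← hm] at hmean
  have hNm : (N : ℝ) * ((1 - (∑' y : L, gaussianFunction s ((y : V) - x)) / ∑' y : L, gaussianFunction s (y : V)) /
      (2 * π ^ 2)) ≤ N * m :=
    mul_le_mul_of_nonneg_left hmean (Nat.cast_nonneg _)
  -- the bad set is inside the union
  have hsub : {ω : Fin N → dualLattice L | ¬ ((∀ j, ‖(ω j : V)‖ < R) ∧
      (N * ((1 - (∑' y : L, gaussianFunction s ((y : V) - x)) / ∑' y : L, gaussianFunction s (y : V)) /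
          (2 * π ^ 2)) - a < ∑ j, distInt ⟪x, (ω j : V)⟫_ℝ ^ 2) ∧
      (∑ k : ι × ι, (∑ j, momentEntry b R k (ω j : V) - N * ∫ w, momentEntry b R k (w : V) ∂μ) ^ 2 < θ))} ⊆
      B1 ∪ B2 ∪ B3 := by
    intro ω hω
    simp only [Set.mem_setOf_eq, not_and_or, not_forall, not_lt] at hω
    rcases hω with ⟨j, hj⟩ | hω2 | hω3
    · exact Or.inl (Or.inl ⟨j, hj⟩)
    · refine Or.inl (Or.inr ?_)
      show ∑ j, distInt ⟪x, (ω j : V)⟫_ℝ ^ 2 ≤ N * m - a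
      linarith
    · exact Or.inr hω3
  calc (IID.draws μ N).real _ ≤ (IID.draws μ N).real (B1 ∪ B2 ∪ B3) := measureReal_mono hsub
    _ ≤ (IID.draws μ N).real B1 + (IID.draws μ N).real B2 + (IID.draws μ N).real B3 :=
        (measureReal_union_le _ _).trans (add_le_add (measureReal_union_le _ _) le_rfl)
    _ ≤ _ := add_le_add (add_le_add h1 h2) h3

end Sampling

/-! ### The NO case of Regev's Lemma 3.20 for the integer verifier -/

namespace ARVerifier

variable {I : LatticeInstance}

/-- The tail constant of AR Lemma 3.1 with `c = 1`: `√(2πe) e^{-π} ≤ 5/16`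
(`√(2πe) ≤ 5`, `e^{-π} ≤ e^{-3} ≤ 2⁻⁴`). [folklore] -/
theorem const_one_le : 1 * Real.sqrt (2 * π * Real.exp 1) * Real.exp (-π * 1 ^ 2) ≤ 5 / 16 := by
  have h1 := sqrt_two_pi_e_le_five
  have h2 : Real.exp (-π * 1 ^ 2) ≤ Real.exp (-(3 : ℕ)) :=
    Real.exp_le_exp.2 (by have := Real.pi_gt_three; push_cast; nlinarith)
  have h3 : Real.exp (-((3 : ℕ) : ℝ)) ≤ (2⁻¹ : ℝ) ^ 4 := exp_neg_le_two_pow (by norm_num)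
  calc 1 * Real.sqrt (2 * π * Real.exp 1) * Real.exp (-π * 1 ^ 2) ≤ 1 * 5 * (2⁻¹ : ℝ) ^ 4 := by
        gcongr
        exact h2.trans h3
    _ = 5 / 16 := by norm_num

/-- **AR Lemma 3.1 at Regev's distance**: if every lattice point is at distance `≥ s√n` from `x`
(`n ≥ 1`) then `f_s(x) = ρ_s(L − x)/ρ_s(L) ≤ √(2πe) e^{-π} ≤ 5/16` (Banaszczyk's tail bound with
`c = 1 ≥ 1/√(2π)`, `GaussianLatticeTails.lean`). [cite: AharonovRegev2005, Lemma 3.1 (p. 8) — variant] -/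
theorem fRatio_le_of_far_one {I : LatticeInstance} [IsZLattice ℝ I.lattice] (hn : 1 ≤ I.n) {s : ℝ} (hs0 : 0 < s)
    (x : EuclideanSpace ℝ (Fin I.n))
    (hfar : ∀ y : I.lattice, 1 * s * Real.sqrt (finrank ℝ (EuclideanSpace ℝ (Fin I.n))) ≤ ‖(y : EuclideanSpace ℝ (Fin I.n)) - x‖) :
    (∑' y : I.lattice, gaussianFunction s ((y : EuclideanSpace ℝ (Fin I.n)) - x)) /
        (∑' y : I.lattice, gaussianFunction s (y : EuclideanSpace ℝ (Fin I.n))) ≤ 5 / 16 := by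
  have hc1 : 1 / Real.sqrt (2 * π) ≤ 1 := by
    rw [div_le_iff₀ (Real.sqrt_pos.2 (by positivity))]
    have : (1 : ℝ) ≤ Real.sqrt (2 * π) := Real.one_le_sqrt.2 (by linarith [Real.pi_gt_three])
    linarith
  have hZ : 0 < ∑' y : I.lattice, gaussianFunction s (y : EuclideanSpace ℝ (Fin I.n)) := by
    have := tsum_gaussianFunction_sub_pos I.lattice hs0.ne' (0 : EuclideanSpace ℝ (Fin I.n))
    simpa only [sub_zero] using this
  have h31 := tsum_gaussianFunction_sub_le_pow_mul_of_forall_le I.lattice hs0 hc1 hfar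
  rw [div_le_iff₀ hZ]
  refine h31.trans (mul_le_mul_of_nonneg_right ?_ hZ.le)
  have hC0 : 0 ≤ 1 * Real.sqrt (2 * π * Real.exp 1) * Real.exp (-π * 1 ^ 2) := by positivity
  have hC1 : 1 * Real.sqrt (2 * π * Real.exp 1) * Real.exp (-π * 1 ^ 2) ≤ 1 := const_one_le.trans (by norm_num)
  rw [finrank_euclideanSpace_fin]
  calc (1 * Real.sqrt (2 * π * Real.exp 1) * Real.exp (-π * 1 ^ 2)) ^ I.n
      ≤ (1 * Real.sqrt (2 * π * Real.exp 1) * Real.exp (-π * 1 ^ 2)) ^ 1 := pow_le_pow_of_le_one hC0 hC1 hn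
    _ ≤ 5 / 16 := by rw [pow_one]; exact const_one_le

/-- The check-3 margin with `f ≤ 5/16`: `N/50 ≤ N (1 − 5/16)/(2π²) − N/100` (`π² ≤ 10`). [folklore] -/
theorem const_ineq_one {Nr : ℝ} (hN : 0 ≤ Nr) :
    Nr / 50 ≤ Nr * ((1 - 5 / 16) / (2 * π ^ 2)) - Nr / 100 := by
  have hπ : π ^ 2 ≤ 10 := by have := Real.pi_lt_d2; have := Real.pi_pos; nlinarith
  have hπ0 : 0 < 2 * π ^ 2 := by positivity
  have hkey : (1 : ℝ) / 50 + 1 / 100 ≤ (1 - 5 / 16) / (2 * π ^ 2) := by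
    rw [le_div_iff₀ hπ0]; nlinarith
  nlinarith [mul_le_mul_of_nonneg_left hkey hN]

/-- **The budget is at most `171/1000`** (quantitative form of `budget_lt_one`): for `n ≥ 1`,
`s > 0`, `N = nSamples n = 3000 (n+1)⁴`, tail constant `c = 3`, deviation `a = N/100`, level
`√θ = N/(2s²)`: `N (3√(2πe)e^{-9π})ⁿ + N/(64 a²)·(…) + 324 n⁴/N ≤ 1/100 + 53/1000 + 108/1000`.
[folklore] -/
theorem budget_le {n : ℕ} (hn : 1 ≤ n) {s : ℝ} (hs0 : 0 < s) :
    (nSamples n : ℝ) * (3 * Real.sqrt (2 * π * Real.exp 1) * Real.exp (-π * 3 ^ 2)) ^ finrank ℝ (EuclideanSpace ℝ (Fin n)) +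
        (nSamples n : ℝ) * (1 / 4) ^ 2 / (4 * ((nSamples n : ℝ) / 100) ^ 2) +
        (nSamples n : ℝ) * Fintype.card (Fin n × Fin n) *
            ((3 * s⁻¹ * Real.sqrt (finrank ℝ (EuclideanSpace ℝ (Fin n)))) ^ 2) ^ 2 /
          ((nSamples n : ℝ) / (2 * s ^ 2)) ^ 2 ≤ 171 / 1000 := by
  rw [finrank_euclideanSpace_fin, Fintype.card_prod, Fintype.card_fin]
  have hN0 : (0 : ℝ) < nSamples n := by exact_mod_cast nSamples_pos n
  have hN3 : (3000 : ℝ) ≤ nSamples n := by exact_mod_cast le_nSamples n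
  have hN4 : 3000 * (n : ℝ) ^ 4 ≤ nSamples n := by exact_mod_cast pow_four_le_nSamples n
  -- term 1
  have h1 : (nSamples n : ℝ) * (3 * Real.sqrt (2 * π * Real.exp 1) * Real.exp (-π * 3 ^ 2)) ^ n ≤ 1 / 100 := by
    have hC0 : 0 ≤ 3 * Real.sqrt (2 * π * Real.exp 1) * Real.exp (-π * 3 ^ 2) := by positivity
    calc (nSamples n : ℝ) * (3 * Real.sqrt (2 * π * Real.exp 1) * Real.exp (-π * 3 ^ 2)) ^ n
        ≤ (nSamples n : ℝ) * ((2⁻¹ : ℝ) ^ 34) ^ n := by gcongr; exact const_three_le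
      _ = 3000 * ((n : ℝ) + 1) ^ 4 * ((2⁻¹ : ℝ) ^ 34) ^ n := by rw [cast_nSamples]
      _ ≤ 1 / 100 := budget_term1 n hn
  -- term 2
  have h2 : (nSamples n : ℝ) * (1 / 4) ^ 2 / (4 * ((nSamples n : ℝ) / 100) ^ 2) ≤ 53 / 1000 := by
    rw [div_le_iff₀ (by positivity)]
    nlinarith
  -- term 3
  have h3 : (nSamples n : ℝ) * ((n * n : ℕ) : ℝ) * ((3 * s⁻¹ * Real.sqrt (n : ℝ)) ^ 2) ^ 2 /
      ((nSamples n : ℝ) / (2 * s ^ 2)) ^ 2 ≤ 108 / 1000 := by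
    have hsq : Real.sqrt (n : ℝ) ^ 2 = n := Real.sq_sqrt (Nat.cast_nonneg _)
    have hval : (nSamples n : ℝ) * ((n * n : ℕ) : ℝ) * ((3 * s⁻¹ * Real.sqrt (n : ℝ)) ^ 2) ^ 2 /
        ((nSamples n : ℝ) / (2 * s ^ 2)) ^ 2 = 324 * (n : ℝ) ^ 4 / nSamples n := by
      push_cast
      rw [mul_pow, mul_pow, hsq]
      field_simp
      ring
    rw [hval, div_le_iff₀ hN0]
    nlinarith
  linarith

/-- **Regev 2009, Lemma 3.20, NO case — the integer Aharonov–Regev verifier accepts random dual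
samples.** Let `B` be nonsingular of dimension `n`, `d > 0`, and `dist(t, L(B)) > 100 √n · d`. Draw
`N = nSamples n` independent samples `ω = (w₁, …, w_N)` from `D_{L(B)*, 1/(100d)}` (the tree's
`dualGaussian (L(B)) (100 d)`); then with probability at least `829/1000` the certificate
`certOf I t ω` built from them (`C = adj B`, `D = det B`, `aⱼ = B wⱼ`, `mⱼ = round ⟪t, wⱼ⟫`) is
accepted by `ARVerifier.Accepts`. Printed: "`w₁, …, w_N` are … valid samples from `D_{L*,1/(100d)}`.
Moreover, `dist(t, L) > 100√n γ(n) d ≥ 100√n d`, and hence `𝒱` accepts with probability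
exponentially close to `1`" (Regev) / "a random witness chosen according to `f̂` satisfies each of the
above tests with probability at least `3/4`" (AR05 §6.2); the constant `829/1000 = 1 − 171/1000` is
that of the tree's second-moment analysis (`budget_le`). Ingredients: `fRatio_le_of_far_one`,
`measureReal_not_good_dualSamples_le` (`c = 3`, `a = N/100`, `√θ = N/(2s²)`, `s = 100d`),
`sum_inner_sq_le_of_good`, `accepts_certOf`.
[cite: Regev2009, Lemma 3.20 (proof, NO case, p. 22)] [cite: AharonovRegev2005, §6.2 (Completeness) — variant] -/
theorem le_measureReal_accepts_certOf [IsZLattice ℝ I.lattice] (hI : I.IsNonsingular) {t : Fin I.n → ℤ} {d : ℚ}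
    (hd : 0 < d)
    (hfar : 100 * Real.sqrt (I.n : ℝ) * (d : ℝ) <
      infDist (intVecToEuclidean I.n t) (I.lattice : Set (EuclideanSpace ℝ (Fin I.n)))) :
    (829 : ℝ) / 1000 ≤ (IID.draws (dualGaussian I.lattice (100 * (d : ℝ))).toMeasure (nSamples I.n)).real
      {ω | Accepts I.basis t d (certOf I t ω)} := by
  -- positive dimension
  have hn : 1 ≤ I.n := by
    by_contra h0
    have h00 : I.n = 0 := by omega
    have hz := infDist_targetE_eq_zero_of_n_eq_zero (c := (⟨I, t⟩ : CVPInstance)) h00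
    change infDist (intVecToEuclidean I.n t) (I.lattice : Set (EuclideanSpace ℝ (Fin I.n))) = 0 at hz
    rw [hz, h00, Nat.cast_zero, Real.sqrt_zero, mul_zero, zero_mul] at hfar
    exact lt_irrefl _ hfar
  have hdR : (0 : ℝ) < d := by exact_mod_cast hd
  set s : ℝ := 100 * (d : ℝ) with hs
  have hs0 : 0 < s := by rw [hs]; positivity
  have hN0 : (0 : ℝ) < nSamples I.n := by exact_mod_cast nSamples_pos I.n
  set N : ℕ := nSamples I.n with hNdef
  set x : EuclideanSpace ℝ (Fin I.n) := intVecToEuclidean I.n t with hx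
  set μ := (dualGaussian I.lattice s).toMeasure with hμ
  -- AR Lemma 3.1 input: every lattice point is `≥ s √n` away
  have hfarall : ∀ y : I.lattice, 1 * s * Real.sqrt (finrank ℝ (EuclideanSpace ℝ (Fin I.n))) ≤
      ‖(y : EuclideanSpace ℝ (Fin I.n)) - x‖ := by
    intro y
    rw [finrank_euclideanSpace_fin]
    have h1 : infDist x (I.lattice : Set (EuclideanSpace ℝ (Fin I.n))) ≤ dist x y := infDist_le_dist_of_mem y.2
    rw [dist_eq_norm, ← norm_neg, neg_sub] at h1
    have : 1 * s * Real.sqrt (I.n : ℝ) = 100 * Real.sqrt (I.n : ℝ) * d := by rw [hs]; ring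
    linarith
  have hf := fRatio_le_of_far_one hn hs0 x hfarall
  -- parameters of the sampling budget
  have hc3 : 1 / Real.sqrt (2 * π) ≤ 3 := by
    rw [div_le_iff₀ (Real.sqrt_pos.2 (by positivity))]
    have : (1 : ℝ) ≤ Real.sqrt (2 * π) := Real.one_le_sqrt.2 (by linarith [Real.pi_gt_three])
    linarith
  have ha : (0 : ℝ) < (N : ℝ) / 100 := by positivity
  have hθ : (0 : ℝ) < ((N : ℝ) / (2 * s ^ 2)) ^ 2 := by positivity
  set b := EuclideanSpace.basisFun (Fin I.n) ℝ with hb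
  have hR0 : 0 < 3 * s⁻¹ * Real.sqrt (finrank ℝ (EuclideanSpace ℝ (Fin I.n))) := by
    rw [finrank_euclideanSpace_fin]
    have : 0 < Real.sqrt (I.n : ℝ) := Real.sqrt_pos.2 (by exact_mod_cast hn)
    positivity
  -- the good event
  set G : Set (Fin N → dualLattice I.lattice) := {ω |
      (∀ j, ‖(ω j : EuclideanSpace ℝ (Fin I.n))‖ < 3 * s⁻¹ * Real.sqrt (finrank ℝ (EuclideanSpace ℝ (Fin I.n)))) ∧
      (N * ((1 - (∑' y : I.lattice, gaussianFunction s ((y : EuclideanSpace ℝ (Fin I.n)) - x)) /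
          ∑' y : I.lattice, gaussianFunction s (y : EuclideanSpace ℝ (Fin I.n))) / (2 * π ^ 2)) - (N : ℝ) / 100 <
        ∑ j, distInt ⟪x, (ω j : EuclideanSpace ℝ (Fin I.n))⟫_ℝ ^ 2) ∧
      (∑ k : Fin I.n × Fin I.n, (∑ j, momentEntry b (3 * s⁻¹ * Real.sqrt (finrank ℝ (EuclideanSpace ℝ (Fin I.n)))) k
            (ω j : EuclideanSpace ℝ (Fin I.n)) -
          N * ∫ w, momentEntry b (3 * s⁻¹ * Real.sqrt (finrank ℝ (EuclideanSpace ℝ (Fin I.n)))) k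
            (w : EuclideanSpace ℝ (Fin I.n)) ∂μ) ^ 2 < ((N : ℝ) / (2 * s ^ 2)) ^ 2)} with hG
  -- good tuples are accepted
  obtain ⟨_, hk2⟩ := const_ineqs hN0.le
  have hk1 := const_ineq_one hN0.le
  have hGA : G ⊆ {ω | Accepts I.basis t d (certOf I t ω)} := by
    rintro ω ⟨hω1, hω2, hω3⟩
    have hop : ∀ u : EuclideanSpace ℝ (Fin I.n), ∑ j, ⟪u, (ω j : EuclideanSpace ℝ (Fin I.n))⟫_ℝ ^ 2 ≤
        ((N : ℝ) * (π / (8 * s ^ 2)) + Real.sqrt (((N : ℝ) / (2 * s ^ 2)) ^ 2)) * ‖u‖ ^ 2 :=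
      sum_inner_sq_le_of_good I.lattice hs0 hR0 b (fun j ↦ (hω1 j).le) hω3.le
    refine accepts_certOf hI t hd ω ?_ (by positivity) ?_ hop
    · -- check 3 input: `N/50 ≤ ∑ distInt²`
      have hmono : (N : ℝ) * ((1 - 5 / 16) / (2 * π ^ 2)) ≤
          (N : ℝ) * ((1 - (∑' y : I.lattice, gaussianFunction s ((y : EuclideanSpace ℝ (Fin I.n)) - x)) /
            ∑' y : I.lattice, gaussianFunction s (y : EuclideanSpace ℝ (Fin I.n))) / (2 * π ^ 2)) :=
        mul_le_mul_of_nonneg_left (div_le_div_of_nonneg_right (by linarith) (by positivity)) hN0.le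
      change (N : ℝ) / 50 ≤ ∑ j, distInt ⟪x, (ω j : EuclideanSpace ℝ (Fin I.n))⟫_ℝ ^ 2
      linarith
    · -- `λ ≤ 2 N q²/(100 p)²`
      rw [Real.sqrt_sq (by positivity)]
      have hdq : (d : ℝ) * ((d.den : ℕ) : ℝ) = ((d.num : ℤ) : ℝ) := by exact_mod_cast Rat.mul_den_eq_num d
      have hs2 : 2 * (nSamples I.n : ℝ) * ((d.den : ℕ) : ℝ) ^ 2 / (100 * ((d.num : ℤ) : ℝ)) ^ 2 =
          2 * (N : ℝ) / s ^ 2 := by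
        rw [← hdq, hs, hNdef]; field_simp
      have hlhs : (N : ℝ) * (π / (8 * s ^ 2)) + (N : ℝ) / (2 * s ^ 2) = (N : ℝ) * (π / 8 + 1 / 2) / s ^ 2 := by
        field_simp
      rw [hs2, hlhs, div_le_div_iff_of_pos_right (by positivity)]
      exact hk2
  -- the bad tuples have probability `≤ 171/1000`
  have hbad : (IID.draws μ N).real Gᶜ ≤ 171 / 1000 := by
    have h := measureReal_not_good_dualSamples_le I.lattice hs0 hc3 ha hθ x b N
    rw [← hμ] at h
    exact h.trans (budget_le hn hs0)
  -- complement
  have hGc : (IID.draws μ N).real G = 1 - (IID.draws μ N).real Gᶜ := by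
    have h := measureReal_add_measureReal_compl (μ := IID.draws μ N) (s := G) (Set.to_countable G).measurableSet
    rw [probReal_univ] at h
    linarith
  calc (829 : ℝ) / 1000 ≤ 1 - (IID.draws μ N).real Gᶜ := by linarith
    _ = (IID.draws μ N).real G := hGc.symm
    _ ≤ (IID.draws μ N).real {ω | Accepts I.basis t d (certOf I t ω)} := measureReal_mono hGA

/-- **Promise form, `GapCVP_{100√n}`**: on every NO instance of `GapCVP_{100√n}` (`B` nonsingular,
`d > 0`, `dist(t, L(B)) > 100√n d`) the certificate built from `N` i.i.d. samples of
`D_{L(B)*, 1/(100d)}` is accepted with probability `≥ 829/1000`.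
[cite: AharonovRegev2005, §6.2 (Completeness) — variant] [cite: Regev2009, Lemma 3.20 (proof, NO case)] -/
theorem le_measureReal_accepts_certOf_of_gapCVP_no [IsZLattice ℝ I.lattice] {t : Fin I.n → ℤ} {d : ℚ}
    (hp : ((⟨I, t⟩ : CVPInstance), d) ∈ GapCVP.no (fun n ↦ 100 * Real.sqrt n)) :
    (829 : ℝ) / 1000 ≤ (IID.draws (dualGaussian I.lattice (100 * (d : ℝ))).toMeasure (nSamples I.n)).real
      {ω | Accepts I.basis t d (certOf I t ω)} := by
  obtain ⟨hI, hd, hfar⟩ := hp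
  exact le_measureReal_accepts_certOf hI hd hfar

/-- **Promise form for Regev's Lemma 3.20**: on every NO instance of `GapCVP′_{100√n·γ}` with
`γ ≥ 1` (MR07 Def. 5.21 sets of `GapCVPPrime.lean`: `λ₁(L(B)) > 100√n γ d` and
`dist(k t, L(B)) > 100√n γ d` for odd `k`; in particular `dist(t, L(B)) > 100√n γ d ≥ 100√n d`) the
certificate built from `N` i.i.d. samples of `D_{L(B)*, 1/(100d)}` is accepted with probability
`≥ 829/1000`. (The first NO condition is what makes `(L*, 1/(100d))` a valid `DGS` query; it is not
used here.) [cite: Regev2009, Lemma 3.20 (proof, NO case, p. 22)] -/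
theorem le_measureReal_accepts_certOf_of_gapCVP'_no [IsZLattice ℝ I.lattice] {γ : ℕ → ℝ} (hγ : ∀ n, 1 ≤ γ n)
    {t : Fin I.n → ℤ} {d : ℚ}
    (hp : ((⟨I, t⟩ : CVPInstance), d) ∈ GapCVP'.no (fun k ↦ 100 * Real.sqrt k * γ k)) :
    (829 : ℝ) / 1000 ≤ (IID.draws (dualGaussian I.lattice (100 * (d : ℝ))).toMeasure (nSamples I.n)).real
      {ω | Accepts I.basis t d (certOf I t ω)} := by
  obtain ⟨hI, hd, hfar⟩ := GapCVP'.no_subset_gapCVP_no _ hp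
  refine le_measureReal_accepts_certOf hI hd (lt_of_le_of_lt ?_ hfar)
  change 100 * Real.sqrt (I.n : ℝ) * (d : ℝ) ≤ 100 * Real.sqrt (I.n : ℝ) * γ I.n * (d : ℝ)
  have hdR : (0 : ℝ) ≤ d := by exact_mod_cast hd.le
  have h1 : 100 * Real.sqrt (I.n : ℝ) ≤ 100 * Real.sqrt (I.n : ℝ) * γ I.n :=
    le_mul_of_one_le_right (by positivity) (hγ _)
  exact mul_le_mul_of_nonneg_right h1 hdR

/-- **Completeness in existence form at gap `100√n`** (improving the constant `200√n` of
`exists_accepts_of_far`): for every NO instance of `GapCVP_{100√n}` some dual sample tuple yields an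
accepted certificate. [cite: AharonovRegev2005, §6.2 (Completeness, pp. 11–12) — variant] -/
theorem exists_accepts_of_far_one {t : Fin I.n → ℤ} {d : ℚ}
    (hp : ((⟨I, t⟩ : CVPInstance), d) ∈ GapCVP.no (fun n ↦ 100 * Real.sqrt n)) :
    ∃ ω : Fin (nSamples I.n) → dualLattice I.lattice, Accepts I.basis t d (certOf I t ω) := by
  haveI : IsZLattice ℝ I.lattice := LatticeInstance.isZLattice_of_isNonsingular hp.1
  have h := le_measureReal_accepts_certOf_of_gapCVP_no hp
  by_contra hne
  push Not at hne
  have hempty : {ω : Fin (nSamples I.n) → dualLattice I.lattice | Accepts I.basis t d (certOf I t ω)} = ∅ :=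
    Set.eq_empty_of_forall_notMem fun ω hω ↦ hne ω hω
  rw [hempty, measureReal_empty] at h
  norm_num at h

end ARVerifier

end Literature.Algebra.EuclideanLattices

end
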